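import Mathlib.Analysis.SpecialFunctions.Complex.Arg
import Mathlib.Analysis.SpecialFunctions.Trigonometric.Basic
import Mathlib.Analysis.SpecialFunctions.Exp
import HarnessLib

/-!
# Non-vanishing of oscillating sequences `cos(nθ + β)` and `Re(e^{inω}(L + o(1)))`

Topic `Literature/Analysis/Asymptotics`. Everything in this file is PROVED; no definitions, no
named facts.

When the saddle-point method is applied to a real quantity `F_n = Re J_n` whose complex
companion has the asymptotics `J_n = ρ_n e^{inω} (L + o(1))` (`ρ_n > 0`, `L ≠ 0`) — two complex
conjugate saddle points — one gets `F_n = ρ_n (|L| cos(nω + arg L) + o(1))`, and the conclusion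
"`limsup |F_n|^{1/n} = lim ρ_n^{1/n}`, in particular `F_n ≠ 0` for infinitely many `n`" needs
exactly that `cos(nω + β)` does not tend to `0`, which holds iff `ω ∉ πℤ` (`sin ω ≠ 0`). This is
the hypothesis "`Im f₀(τ₀) ∉ πℤ`" of Zudilin's asymptotic lemma for linear forms in odd zeta values
(J. Théor. Nombres Bordeaux 16 (2004), Lemma 20; Izv. Math. 66 (2002), Lemma 6).

* `not_tendsto_cos_nat_mul_add` — if `sin θ ≠ 0` then `cos(nθ + β) ↛ 0`
  (from `cos((n+1)θ+β) = cos(nθ+β) cos θ − sin(nθ+β) sin θ` and `cos² + sin² = 1`);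
* `exists_frequently_le_abs_cos` — hence `|cos(nθ + β)| ≥ ε` for infinitely many `n`, some `ε > 0`;
* `exists_frequently_le_abs_re_cexp_mul` — for `L ≠ 0`, `sin ω ≠ 0`, `ε_n → 0`:
  `|Re(e^{inω}(L + ε_n))| ≥ c` for infinitely many `n`, some `c > 0`; in particular
  `Re(e^{inω}(L + ε_n)) ≠ 0` infinitely often (`frequently_re_cexp_mul_ne_zero`).
-/

noncomputable section

open _root_.Filter _root_.Complex
open scoped _root_.Topology _root_.Real

namespace Literature.Analysis.Asymptotics

/-- If `sin θ ≠ 0` (i.e. `θ ∉ πℤ`) then `cos(nθ + β)` does not tend to `0` as `n → ∞`: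
otherwise `sin(nθ + β) sin θ = cos(nθ+β) cos θ − cos((n+1)θ + β) → 0`, so `sin(nθ+β) → 0` too,
contradicting `cos² + sin² = 1`. [folklore] -/
theorem not_tendsto_cos_nat_mul_add {θ : ℝ} (hθ : Real.sin θ ≠ 0) (β : ℝ) :
    ¬ Tendsto (fun n : ℕ => Real.cos (n * θ + β)) atTop (𝓝 0) := by
  intro hcos
  -- `cos((n+1)θ + β) → 0`
  have hcos1 : Tendsto (fun n : ℕ => Real.cos ((n + 1 : ℕ) * θ + β)) atTop (𝓝 0) :=
    hcos.comp (tendsto_add_atTop_nat 1)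
  -- `sin(nθ+β) sin θ = cos(nθ+β) cos θ - cos((n+1)θ+β)`
  have hsin : Tendsto (fun n : ℕ => Real.sin (n * θ + β)) atTop (𝓝 0) := by
    have h1 : Tendsto (fun n : ℕ => (Real.cos (n * θ + β) * Real.cos θ
        - Real.cos ((n + 1 : ℕ) * θ + β)) / Real.sin θ) atTop (𝓝 0) := by
      simpa using ((hcos.mul_const (Real.cos θ)).sub hcos1).div_const (Real.sin θ)
    refine h1.congr fun n => ?_
    have : Real.cos ((n + 1 : ℕ) * θ + β) =
        Real.cos (n * θ + β) * Real.cos θ - Real.sin (n * θ + β) * Real.sin θ := by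
      rw [← Real.cos_add]; push_cast; ring_nf
    rw [this]
    field_simp
    ring
  -- contradiction with `cos² + sin² = 1`
  have h2 : Tendsto (fun n : ℕ => Real.cos (n * θ + β) ^ 2 + Real.sin (n * θ + β) ^ 2) atTop
      (𝓝 (0 ^ 2 + 0 ^ 2)) := (hcos.pow 2).add (hsin.pow 2)
  simp only [Real.cos_sq_add_sin_sq] at h2
  norm_num at h2

/-- If `sin θ ≠ 0` there is `ε > 0` with `|cos(nθ + β)| ≥ ε` for infinitely many `n`. [folklore] -/
theorem exists_frequently_le_abs_cos {θ : ℝ} (hθ : Real.sin θ ≠ 0) (β : ℝ) :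
    ∃ ε : ℝ, 0 < ε ∧ ∃ᶠ n : ℕ in atTop, ε ≤ |Real.cos (n * θ + β)| := by
  by_contra h
  push Not at h
  apply not_tendsto_cos_nat_mul_add hθ β
  rw [Metric.tendsto_nhds]
  intro ε hε
  filter_upwards [h ε hε] with n hn
  simpa using hn

/-- `Re(e^{it} L) = |L| cos(t + arg L)`. [folklore] -/
theorem re_cexp_mul_I_mul (t : ℝ) (L : ℂ) :
    (cexp (t * I) * L).re = ‖L‖ * Real.cos (t + arg L) := by
  conv_lhs => rw [← norm_mul_exp_arg_mul_I L]
  rw [show cexp (t * I) * (‖L‖ * cexp (arg L * I)) = ‖L‖ * (cexp (t * I) * cexp (arg L * I)) by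
    ring, ← Complex.exp_add, show (t : ℂ) * I + arg L * I = ((t + arg L : ℝ) : ℂ) * I by
    push_cast; ring, re_ofReal_mul, exp_ofReal_mul_I_re]

/-- **Two conjugate saddle points do not cancel infinitely often.** If `L ≠ 0`, `sin ω ≠ 0` and
`ε_n → 0` in `ℂ`, then for some `c > 0`, `|Re(e^{inω}(L + ε_n))| ≥ c` for infinitely many `n`
(namely `c = |L| ε/2` with `ε` from `exists_frequently_le_abs_cos`). [folklore] -/
theorem exists_frequently_le_abs_re_cexp_mul {L : ℂ} (hL : L ≠ 0) {ω : ℝ} (hω : Real.sin ω ≠ 0)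
    {ε : ℕ → ℂ} (hε : Tendsto ε atTop (𝓝 0)) :
    ∃ c : ℝ, 0 < c ∧ ∃ᶠ n : ℕ in atTop, c ≤ |(cexp ((n * ω : ℝ) * I) * (L + ε n)).re| := by
  obtain ⟨e, he, hfreq⟩ := exists_frequently_le_abs_cos hω (arg L)
  have hLpos : 0 < ‖L‖ := norm_pos_iff.2 hL
  refine ⟨‖L‖ * e / 2, by positivity, ?_⟩
  have hsmall : ∀ᶠ n : ℕ in atTop, ‖ε n‖ ≤ ‖L‖ * e / 2 := by
    have := (tendsto_zero_iff_norm_tendsto_zero.1 hε).eventually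
      (Iic_mem_nhds (show (0 : ℝ) < ‖L‖ * e / 2 by positivity))
    filter_upwards [this] with n hn using hn
  refine (hfreq.and_eventually hsmall).mono fun n ⟨hn, hn'⟩ => ?_
  have hmain : (cexp ((n * ω : ℝ) * I) * (L + ε n)).re =
      ‖L‖ * Real.cos (n * ω + arg L) + (cexp ((n * ω : ℝ) * I) * ε n).re := by
    rw [mul_add, add_re, re_cexp_mul_I_mul]
  have herr : |(cexp ((n * ω : ℝ) * I) * ε n).re| ≤ ‖L‖ * e / 2 := by
    refine (abs_re_le_norm _).trans ?_
    rw [norm_mul, norm_exp_ofReal_mul_I, one_mul]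
    exact hn'
  rw [hmain]
  have h1 : ‖L‖ * e ≤ |‖L‖ * Real.cos (n * ω + arg L)| := by
    rw [abs_mul, abs_of_pos hLpos]
    exact mul_le_mul_of_nonneg_left hn hLpos.le
  have := abs_add_le (‖L‖ * Real.cos (↑n * ω + L.arg) + (cexp (↑(↑n * ω) * I) * ε n).re)
    (-(cexp (↑(↑n * ω) * I) * ε n).re)
  rw [abs_neg, add_neg_cancel_right] at this
  linarith

/-- In particular `Re(e^{inω}(L + ε_n)) ≠ 0` for infinitely many `n`. [folklore] -/
theorem frequently_re_cexp_mul_ne_zero {L : ℂ} (hL : L ≠ 0) {ω : ℝ} (hω : Real.sin ω ≠ 0)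
    {ε : ℕ → ℂ} (hε : Tendsto ε atTop (𝓝 0)) :
    ∃ᶠ n : ℕ in atTop, (cexp ((n * ω : ℝ) * I) * (L + ε n)).re ≠ 0 := by
  obtain ⟨c, hc, h⟩ := exists_frequently_le_abs_re_cexp_mul hL hω hε
  exact h.mono fun n hn h0 => by rw [h0, abs_zero] at hn; linarith

/-- The form used for real sequences: if `F n = ρ n · Re(e^{inω}(L + ε n))` with `ρ n ≠ 0`,
`L ≠ 0`, `sin ω ≠ 0`, `ε n → 0`, then `F n ≠ 0` for infinitely many `n`. [folklore] -/
theorem frequently_ne_zero_of_eq_mul_re {F ρ : ℕ → ℝ} {L : ℂ} (hL : L ≠ 0) {ω : ℝ}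
    (hω : Real.sin ω ≠ 0) {ε : ℕ → ℂ} (hε : Tendsto ε atTop (𝓝 0)) (hρ : ∀ n, ρ n ≠ 0)
    (hF : ∀ n, F n = ρ n * (cexp ((n * ω : ℝ) * I) * (L + ε n)).re) :
    ∃ᶠ n : ℕ in atTop, F n ≠ 0 :=
  (frequently_re_cexp_mul_ne_zero hL hω hε).mono fun n hn => by
    rw [hF n]; exact mul_ne_zero (hρ n) hn

end Literature.Analysis.Asymptotics
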